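import Literature.NumberTheory.Automorphic.LocalLanglandsGLOne
import Literature.NumberTheory.Automorphic.RankinSelbergLocalTwistProofs
import HarnessLib

/-!
# Sketch (LOCAL part only) — crux-ideate round 1, ideator k = 1, crux stmt-Langlands-17925
`IrreducibilityBySelfDuality.ReciprocityUpToIrreducibilityR`

This is §3 of the ideator's `Sketch.lean` (attached to the item as evidence; the full file also has
§1–§2 = card `rigidity-inheritance` and §4 = the composed line, which import the route's Theses module
and could not be published as a workfile while the farm snapshot of that module is incoherent).
Everything here imports Literature only: the named-fact shape `GaloisSideConverse F` (card
`galois-side-converse`), the computation-free comparison lemmas, and the induction over ranks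
`recGL_eq_of_galoisSideConverse` — all sorry-free.
-/

noncomputable section

open scoped MatrixGroups
open Literature.NumberTheory.Automorphic Literature.NumberTheory.GaloisRepresentations
open Literature.NumberTheory.GaloisRepresentations.IsNonarchimedeanLocalField

namespace Summit.Langlands.Langlands.Cruxes.ReciprocityUpToIrreducibilityR.IdeateR1K1Local

/-! ## §3 Card `galois-side-converse`: rigidity from ONE local named fact, computation-free -/

section Local

open MeasureTheory

variable (F : Type) [Field F] [ValuativeRel F] [TopologicalSpace F] [IsNonarchimedeanLocalField F]

/-- **GC — the Galois-side local converse theorem, relative to a six-clause family** (named-fact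
shape).  PRINTED Galois-side ingredients: Henniart, Bull. SMF 130 (2002): Cor. 1.4 (irreducible
`σ, σ'` with the same `γ(s, σ ⊗ τ, ψ)` for all irreducible `τ` of dimension `< n` are isomorphic —
"aucune démonstration directe n'est connue": Henniart 1993 Thm 1.1 transported through LLC),
Thm. 1.6 (a) (`σ` irreducible iff `L(s, σ ⊗ τ) = 1` for all irreducible `τ`, `dim τ < n`),
Thm. 1.7 (a) (a non-irreducible `σ` is RECOVERED from the pole orders of `L(s, σ ⊗ τ)`, `τ = ρ ⊗ St_d`
indecomposable of dimension `< n`), §2.3–2.4 (`St_n ⊗ St_m`, `L(s, ρ ⊗ St_n) = L(s, ν^{n-1} ρ)`); plus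
Harris–Taylor 2001 Thm A (the probes `rec_m σ`, `σ` generic, of a canonically normalised six-clause
family are all generic-type parameters: every irreducible one and every `ρ ⊗ St_d`).  Statement: two
Frobenius-semisimple `n`-dimensional
Weil–Deligne parameters (`n ≥ 2`) with the same Euler factors and the same `ε`-factors against
`rec_m σ` for EVERY generic `σ ∈ Irr(GL_m(F))`, `1 ≤ m < n`, define the same class — for any
six-clause family `rec` normalised against THE canonical Artin maps (the pins of `ReciprocityData`;
on such data `rec_m` of the generic classes is Harris–Taylor's, so the probes are all generic-type
parameters of dimension `< n`: every irreducible one and every `τ ⊗ Sp_k`). -/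
def GaloisSideConverse : Prop :=
  ∀ (hmul : IsFrobPow.mul (F := F)) (huniq : IsFrobPow.unique (F := F)) (hn : absInertia_normal F)
    (hex : exists_isFrobPow (F := F))
    (hns : WeilGroup.exists_subgroup_le_inertia_isOpen_of_continuous (F := F))
    (d : LocalArtinData F) (𝓔 : LocalEpsilonSystem F), d.IsCanonical →
    (∀ (E : Type) [Field E] [ValuativeRel E] [TopologicalSpace E] [IsNonarchimedeanLocalField E]
      [Algebra F E] [FiniteDimensional F E], (𝓔.artin E).IsCanonical) →
    ∀ (rec : ∀ n : ℕ, IrrClass (GL (Fin n) F) → Quotient (frobSemisimpleWDSetoid F n)),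
    IsLocalLanglandsGL F hmul huniq hn hex hns d 𝓔 rec →
    ∀ (n : ℕ), 2 ≤ n →
      ∀ (φ φ' : {r : WeilDeligneRep F ℂ (Fin n → ℂ) // r.IsFrobSemisimple}),
        (∀ ⦃m : ℕ⦄, 0 < m → m < n → ∀ (σ : SmoothIrrep (GL (Fin m) F)) (ψ : AddChar F Circle),
          ψ.IsContinuousNontrivial → IsGeneric σ.ρ ψ⁻¹ →
            (φ.1.tprod (rec m (IrrClass.mk σ)).out.1).eulerFactor hn hex =
              (φ'.1.tprod (rec m (IrrClass.mk σ)).out.1).eulerFactor hn hex ∧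
            ∀ [MeasurableSpace F] [BorelSpace F] (μ : Measure F) [μ.IsAddHaarMeasure],
              IsSelfDualMeasure ψ μ → ∀ s : ℂ,
                epsilonWD hmul huniq hn hex 𝓔 ψ μ (φ.1.tprod (rec m (IrrClass.mk σ)).out.1) s =
                  epsilonWD hmul huniq hn hex 𝓔 ψ μ (φ'.1.tprod (rec m (IrrClass.mk σ)).out.1) s) →
        (⟦φ⟧ : Quotient (frobSemisimpleWDSetoid F n)) = ⟦φ'⟧

variable {F}
variable {hmul : IsFrobPow.mul (F := F)} {huniq : IsFrobPow.unique (F := F)}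
  {hn : absInertia_normal F} {hex : exists_isFrobPow (F := F)}
  {hns : WeilGroup.exists_subgroup_le_inertia_isOpen_of_continuous (F := F)}
  {d : LocalArtinData F} {𝓔 𝓔' : LocalEpsilonSystem F}
  {rec rec' : ∀ n : ℕ, IrrClass (GL (Fin n) F) → Quotient (frobSemisimpleWDSetoid F n)}

/-- **Computation-free comparison of `L`-factors of pairs.**  Two six-clause families (possibly
with different `ε`-systems) that agree on the class of a generic `σ` of rank `m < n` give their
images of a generic `π` of rank `n` the same Euler factor against `rec_m σ`: instantiate clause
(iii-L) of `rec` at the Galois-side polynomial of `rec` (its right-hand side is `rfl`), read the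
resulting `HasRSLFactor` back through clause (iii-L) of `rec'`.  No value of any Rankin–Selberg
`L`-factor is computed. [cite: HarrisTaylorAMS2001, Thm. A] -/
theorem eulerFactor_eq_of_isLocalLanglandsGL
    (h : IsLocalLanglandsGL F hmul huniq hn hex hns d 𝓔 rec)
    (h' : IsLocalLanglandsGL F hmul huniq hn hex hns d 𝓔' rec')
    {m n : ℕ} (hm : 0 < m) (hmn : m < n) (π : SmoothIrrep (GL (Fin n) F))
    (σ : SmoothIrrep (GL (Fin m) F)) (ψ : AddChar F Circle) (hψ : ψ.IsContinuousNontrivial)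
    (hπ : IsGeneric π.ρ ψ) (hσ : IsGeneric σ.ρ ψ⁻¹)
    [MeasurableSpace (GL (Fin m) F ⧸ upperUnitriangular (Fin m) F)]
    [BorelSpace (GL (Fin m) F ⧸ upperUnitriangular (Fin m) F)]
    (ν : Measure (GL (Fin m) F ⧸ upperUnitriangular (Fin m) F))
    [SMulInvariantMeasure (GL (Fin m) F) (GL (Fin m) F ⧸ upperUnitriangular (Fin m) F) ν]
    [IsFiniteMeasureOnCompacts ν] [ν.IsOpenPosMeasure]
    (hσeq : rec' m (IrrClass.mk σ) = rec m (IrrClass.mk σ)) :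
    ((rec n (IrrClass.mk π)).out.1.tprod (rec m (IrrClass.mk σ)).out.1).eulerFactor hn hex =
      ((rec' n (IrrClass.mk π)).out.1.tprod (rec m (IrrClass.mk σ)).out.1).eulerFactor hn hex := by
  have h1 := h.lFactor_pairs hm hmn π σ ψ hψ hπ hσ ν
    (((rec n (IrrClass.mk π)).out.1.tprod (rec m (IrrClass.mk σ)).out.1).eulerFactor hn hex)
  have h2 := h'.lFactor_pairs hm hmn π σ ψ hψ hπ hσ ν
    (((rec n (IrrClass.mk π)).out.1.tprod (rec m (IrrClass.mk σ)).out.1).eulerFactor hn hex)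
  rw [hσeq] at h2
  exact h2.1 (h1.2 rfl)

/-- **Computation-free comparison of `ε`-factors of pairs** (same normalising `ε`-system; for two
systems with the same Artin data compose with Deligne's uniqueness `localEpsilonSystem_unique_holds`,
PROVED in the tree).  Hypothesis `hmono`: the Galois `ε`-factor of the `rec`-side tensor product is
a monomial `e · q^{-a s}` (Tate/Deligne: `ε(r ⊗ ω_s) = ε(r) q^{-(a(r) + n(ψ) dim r)s}`; also supplied
by JPSS existence of `ε`-data through clause (iii-ε) itself). [cite: HarrisTaylorAMS2001, Thm. A] -/
theorem epsilonWD_eq_of_isLocalLanglandsGL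
    (h : IsLocalLanglandsGL F hmul huniq hn hex hns d 𝓔 rec)
    (h' : IsLocalLanglandsGL F hmul huniq hn hex hns d 𝓔 rec')
    {m n : ℕ} (hm : 0 < m) (hmn : m < n) (π : SmoothIrrep (GL (Fin n) F))
    (σ : SmoothIrrep (GL (Fin m) F)) (ψ : AddChar F Circle) (hψ : ψ.IsContinuousNontrivial)
    (hπ : IsGeneric π.ρ ψ) (hσ : IsGeneric σ.ρ ψ⁻¹)
    [MeasurableSpace F] [BorelSpace F] (μ : Measure F) [μ.IsAddHaarMeasure]
    (hμ : IsSelfDualMeasure ψ μ)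
    [MeasurableSpace (GL (Fin m) F ⧸ upperUnitriangular (Fin m) F)]
    [BorelSpace (GL (Fin m) F ⧸ upperUnitriangular (Fin m) F)]
    (ν : Measure (GL (Fin m) F ⧸ upperUnitriangular (Fin m) F))
    [SMulInvariantMeasure (GL (Fin m) F) (GL (Fin m) F ⧸ upperUnitriangular (Fin m) F) ν]
    [IsFiniteMeasureOnCompacts ν] [ν.IsOpenPosMeasure]
    (hσeq : rec' m (IrrClass.mk σ) = rec m (IrrClass.mk σ))
    (hmono : ∃ (e : ℂ) (a : ℤ), ∀ s : ℂ,
      epsilonWD hmul huniq hn hex 𝓔 ψ μ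
          ((rec n (IrrClass.mk π)).out.1.tprod (rec m (IrrClass.mk σ)).out.1) s =
        e * (((residueFieldCard F : ℂ) ^ (-s)) ^ a)) :
    ∀ s : ℂ, epsilonWD hmul huniq hn hex 𝓔 ψ μ
        ((rec n (IrrClass.mk π)).out.1.tprod (rec m (IrrClass.mk σ)).out.1) s =
      epsilonWD hmul huniq hn hex 𝓔 ψ μ
        ((rec' n (IrrClass.mk π)).out.1.tprod (rec m (IrrClass.mk σ)).out.1) s := by
  obtain ⟨e, a, hea⟩ := hmono
  have h1 := h.epsilon_pairs hm hmn π σ ψ hψ hπ hσ μ hμ ν e a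
  have h2 := h'.epsilon_pairs hm hmn π σ ψ hψ hπ hσ μ hμ ν e a
  rw [hσeq] at h2
  intro s
  rw [hea s, (h2.1 (h1.2 hea)) s]

/-- **Rigidity on generic classes from GC (induction on the rank; Henniart 2002 Cor. 1.8 is the
printed all-pairs analogue).**  Two six-clause families
with the same normalising pair `(d, 𝓔)` agree on every generic class of every rank, granted:
GC; monomiality of the Galois `ε`-factors (`hmono`); independence of genericity from `ψ`
(`IsGeneric.of_isContinuousNontrivial`, named fact); and the existence of the measures the
clauses quantify over (`hν`; the self-dual Haar measure is universally quantified in GC, so its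
existence is not needed).  Ranks `0`/`1` are the tree's `rec_zero_eq_recGLZero` /
`rec_one_eq_recGLOne`.  Neither `localLanglands_gl` nor any Rankin–Selberg computation is used.
[cite: HenniartBSMF2002, Cor. 1.4, Thm. 1.6–1.8] -/
theorem recGL_eq_of_galoisSideConverse (hGC : GaloisSideConverse F) (hd : d.IsCanonical)
    (h𝓔 : ∀ (E : Type) [Field E] [ValuativeRel E] [TopologicalSpace E] [IsNonarchimedeanLocalField E]
      [Algebra F E] [FiniteDimensional F E], (𝓔.artin E).IsCanonical)
    (h : IsLocalLanglandsGL F hmul huniq hn hex hns d 𝓔 rec)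
    (h' : IsLocalLanglandsGL F hmul huniq hn hex hns d 𝓔 rec')
    (hgenψ : ∀ {m : ℕ} (σ : SmoothIrrep (GL (Fin m) F)) (ψ : AddChar F Circle),
      IsGeneric.of_isContinuousNontrivial (π := σ.ρ) (ψ := ψ))
    (hν : ∀ m : ℕ, ∃ (_ : MeasurableSpace (GL (Fin m) F ⧸ upperUnitriangular (Fin m) F))
      (_ : BorelSpace (GL (Fin m) F ⧸ upperUnitriangular (Fin m) F))
      (ν : Measure (GL (Fin m) F ⧸ upperUnitriangular (Fin m) F)),
      SMulInvariantMeasure (GL (Fin m) F) (GL (Fin m) F ⧸ upperUnitriangular (Fin m) F) ν ∧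
      IsFiniteMeasureOnCompacts ν ∧ ν.IsOpenPosMeasure)
    (hmono : ∀ [MeasurableSpace F] [BorelSpace F] (μ : Measure F) (ψ : AddChar F Circle)
      {V : Type} [AddCommGroup V] [Module ℂ V] [FiniteDimensional ℂ V] (r : WeilDeligneRep F ℂ V),
      ∃ (e : ℂ) (a : ℤ), ∀ s : ℂ, epsilonWD hmul huniq hn hex 𝓔 ψ μ r s =
        e * (((residueFieldCard F : ℂ) ^ (-s)) ^ a)) :
    ∀ (n : ℕ) (π : SmoothIrrep (GL (Fin n) F)),
      (∃ ψ : AddChar F Circle, ψ.IsContinuousNontrivial ∧ IsGeneric π.ρ ψ) →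
        rec n (IrrClass.mk π) = rec' n (IrrClass.mk π) := by
  intro n
  induction n using Nat.strong_induction_on with
  | _ n ih =>
    intro π hgen
    rcases Nat.lt_or_ge n 2 with hn2 | hn2
    · interval_cases n
      · rw [h.rec_zero_eq_recGLZero, h'.rec_zero_eq_recGLZero]
      · rw [h.rec_one_eq_recGLOne, h'.rec_one_eq_recGLOne]
    · obtain ⟨ψ₀, hψ₀, hπ₀⟩ := hgen
      have key := hGC hmul huniq hn hex hns d 𝓔 hd h𝓔 rec h n hn2 (rec n (IrrClass.mk π)).out
        (rec' n (IrrClass.mk π)).out ?_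
      · simpa only [Quotient.out_eq] using key
      intro m hm hmn σ ψ hψ hσ
      -- `π` is generic for this `ψ` too, and `σ` is generic for every `ψ'`
      have hπ : IsGeneric π.ρ ψ := hgenψ π ψ₀ hπ₀ hψ₀ hψ
      have hσall : ∃ ψ' : AddChar F Circle, ψ'.IsContinuousNontrivial ∧ IsGeneric σ.ρ ψ' :=
        ⟨ψ⁻¹, hψ.inv, hσ⟩
      have hσeq : rec' m (IrrClass.mk σ) = rec m (IrrClass.mk σ) := (ih m hmn σ hσall).symm
      obtain ⟨_, _, ν, hν1, hν2, hν3⟩ := hν m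
      refine ⟨eulerFactor_eq_of_isLocalLanglandsGL h h' hm hmn π σ ψ hψ hπ hσ ν hσeq, ?_⟩
      intro _ _ μ _ hμs s
      exact epsilonWD_eq_of_isLocalLanglandsGL h h' hm hmn π σ ψ hψ hπ hσ μ hμs ν hσeq
        (hmono μ ψ _) s

end Local


end Summit.Langlands.Langlands.Cruxes.ReciprocityUpToIrreducibilityR.IdeateR1K1Local

end
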